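/-
COR-CM (cell pub-hodgecm2, stage 2 of the Hodge ladder) — junction B01, leg B01-O print-verbatim: the joint theta-pinned end display
with EVERY per-face clause matched to ONE lane — (v-r) back in its GENERATOR form (PerL Lemma 3.5, generation direction) and item
(iii)'s LEVEL-MEETING (stage-1 C1′) as a separate, universally quantified binder in the literal shape of tr-prover-3's
`Model.embOf_levelMeet` (staged `HOME/transposition/item-3/prover/Item3LevelMeetHolds.lean`, not yet landed), so that it plugs BY NAME.
Authored and filed by prover-pub-hodgecm2-b01-x1-0 (extra prover under the single owner of B01, `pub-hodgecm2-own-b01`; assignment (c)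
of HOME/INBOX 16:18:53Z, third file; path pre-ACKed by the lead's NAMING RULING l.4194 (3), `CorCM/B01/FaceWedgeMeet*.lean`), 2026-08-21.
Theorems only: no definition, no instance, no named fact cited as a record, nothing asserted; every import BY NAME; `Interfaces.lean`
(C1), the E term, `Transposition/*` and the other `CorCM/B01/*` files untouched.
FRAMING (COORDINATOR RULING 2026-08-21T11:55:35Z): `HC_CM` is NOT proved; the per-face binder and `hLM` below are OPEN in the tree.
-/
import Summits.HodgeConjecture.CorCM.B01.FaceWedgeMeetJointMeeting
import HarnessLib

/-!
# B01-O, print-verbatim: (3′) `real34Meet` = (v-r) generator form + item (iii) level-meeting — and the display so split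

`CorCM/B01/FaceWedgeMeetJointMeeting.lean` (p292271) displays the coupling leg with the meeting-form inputs C5′ `gen12Meet` and C6′
`real34Meet` read through `Model.embOf`.  C6′ asks its conclusion AT ONE LEVEL, so it silently contains item (iii)'s LEVEL-MEETING
(stage-1 hazard C1 / C1′, `Transposition.AutomorphicMeeting.levelMeet`, `Transposition/Item3Automorphic.lean`): this file makes that
explicit.

* `Transposition.IsolationSpans.real34Meet_of_generators_levelMeet` (every universe, every `emb`): C6′ `real34Meet` ⇐ the GENERATOR
  form of `Real34` (`hr`: every `ϑ_{T′,χ}(Φ)`, `χ` allowed, lies in the closed span of the slot-2,3 theta wedge-functions over all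
  levels — PKG `ThetaRealisation.real34`, tree `IsolationSpans.real34_ofSetting_iff`) + `levelMeet` for `emb` + `Θ₂, Θ₃ ⊆ U_Ψ` +
  the facts `Fact_pull_comp`, `Fact_pull_hodge`, `Fact_cup2_hodge`, `Fact_pull_cup` (closure-span lemma
  `exists_inner_ne_zero_of_mem_closure_span`, level meeting, `pullC_cup2C`, `pullC_mem_Uiso`).
* `Model.exists_periodNV_free_of_jointThetaPin_levelMeet`, `Model.hc_cm_of_jointThetaPin_levelMeet (hHD hI h₁ h₃) (hR) (hLM) (h)`,
  `Model.hc_cm_of_jointThetaPin_levelMeet_rec (hLM) (h)` — the display with per-face binders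
  {DATA `S : FaceThetaSupply` [S2] · DATA `Siso : IsolationSetting H (Lp ℂ 2 V.autMeasure) …` [(v-S)] · (1) `TranslateClosed` ·
  (2′) `gen12Meet` [(v-g′), PKG `Gen12MeetAt`] · (3) `hr` generator form [(v-r), PKG `real34` / `Open_thetaReal34`]}
  and ONE universal binder `hLM` = level-meeting for `Model.embOf` at every `(L, 2 < [L:ℚ], ι₁, V)` — token-shaped on
  `Model.embOf_levelMeet` (tr-prover-3 / p1, item (iii) D3/D4; when it lands, `hLM := fun hL V => embOf_levelMeet _ _ _ _ hL V`).
STRENGTH: (JOINT-LM: `hLM` ∧ `h`) ⇒ JOINT-MEET of `FaceWedgeMeetJointMeeting.lean` (this file's §1) ⇒ free face-period witnesses ⇒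
`HC_CM`; and gen 2's closure-form JOINT (`FaceWedgeMeetJoint.lean`, p291511) at `(HG, emb) := (Lp ℂ 2 V.autMeasure, embOf)` ⇒ `h`
here ((2) ⇒ (2′) by `IsolationSpans.gen12Meet_of_gen12`; (3) = (3) verbatim) but NOT `hLM` (it has `emb_cover` instead, false for
`embOf`).  `HC_CM` is NOT proved.
-/

noncomputable section

open scoped TensorProduct InnerProductSpace

namespace Summit.HodgeConjecture.CorCM

open MeasureTheory
open Literature.AlgebraicGeometry.Motives (CMType HodgeStructure)
open Literature.AlgebraicGeometry.Motives.HodgeStructure (conj)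
open Literature.AlgebraicGeometry.HodgeTheory
open Literature.NumberTheory.Automorphic
open Literature.NumberTheory.Automorphic.PicardCM
open Prior.Perl34File (Perl34.IsolationSetting)
open Prior.Perl34File.Perl34

/-! ## §1  C6′ from the generator form of `Real34` and level-meeting (every universe) -/

namespace Transposition.IsolationSpans

/-- **C6′ `real34Meet` ⇐ (v-r) generator form + item (iii) level-meeting.**  If a (12)-wedge-function of `U_Ψ`-classes at level
`Γ₁` pairs non-trivially with a generator `ϑ_{T′,χ}(Φ)` of the (34) side, and that generator lies in the closed span of the slot-2,3
theta wedge-functions (`hr`), then it pairs non-trivially with ONE of them, `emb Γ₂ (ω₃ ∪ ω₄)` (closure-span lemma); level-meeting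
moves both wedges to one level `Γ` along two morphisms `f, g` of the tower, where `f^*(ω₁ ∪ ω₂) = f^*ω₁ ∪ f^*ω₂` etc.
(`Fact_pull_cup`) are wedges of `U_Ψ`-classes again (`pullC_mem_Uiso`; slots 2, 3 via `Θ ⊆ U_Ψ`). [folklore] -/
theorem real34Meet_of_generators_levelMeet {U : Universe} (hc : U.Fact_pull_comp) (hH : U.Fact_pull_hodge)
    (hcup2 : U.Fact_cup2_hodge) (hpc : U.Fact_pull_cup) {L : CMField} {ι₁ : L →+* ℂ} {V : HermSpace3 L ι₁}
    {H HG CG G SK SigIdx SigIdxG : Type*}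
    [NormedAddCommGroup H] [InnerProductSpace ℂ H] [CompleteSpace H]
    [NormedAddCommGroup HG] [InnerProductSpace ℂ HG] [CompleteSpace HG]
    [NormedAddCommGroup CG] [NormedSpace ℂ CG] [Group G] [TopologicalSpace G] [TopologicalSpace SK]
    {emb : ∀ Γ : Level V, U.CohC (U.pms L ι₁ V Γ) 2 →ₗ[ℂ] HG}
    {Θ : Fin 4 → ∀ Γ : Level V, Set (U.CohC (U.pms L ι₁ V Γ) 1)}
    {K : CMField} {Ψ : Fin 4 → CMType K} {σ : K →+* ℂ}
    (S : Perl34.IsolationSetting H HG CG G SK SigIdx SigIdxG)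
    (Theta_sub : ∀ (i : Fin 4) (Γ : Level V), Θ i Γ ⊆ U.Uiso Γ K (Ψ i) σ)
    (hr : ∀ χ : S.t34.X, S.t34.allowed χ → ∀ Φ : SK,
      S.t34.ϑ χ Φ ∈ (Submodule.span ℂ (thetaWedgeFns U emb Θ 2 3)).topologicalClosure)
    (levelMeet : ∀ (Γ₁ Γ₂ : Level V) (x : U.CohC (U.pms L ι₁ V Γ₁) 2) (y : U.CohC (U.pms L ι₁ V Γ₂) 2),
      x ∈ (U.hodge (U.pms L ι₁ V Γ₁) 2).F 2 → y ∈ (U.hodge (U.pms L ι₁ V Γ₂) 2).F 2 →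
      ⟪emb Γ₂ y, emb Γ₁ x⟫_ℂ ≠ 0 →
        ∃ (Γ : Level V) (f : U.Mor (U.pms L ι₁ V Γ) (U.pms L ι₁ V Γ₁)) (g : U.Mor (U.pms L ι₁ V Γ) (U.pms L ι₁ V Γ₂)),
          ⟪emb Γ (U.pullC g 2 y), emb Γ (U.pullC f 2 x)⟫_ℂ ≠ 0) :
    ∀ χ : S.t34.X, S.t34.allowed χ → ∀ (Φ : SK) (Γ₁ : Level V) (ω₁ ω₂ : U.CohC (U.pms L ι₁ V Γ₁) 1),
      ω₁ ∈ U.Uiso Γ₁ K (Ψ 0) σ → ω₂ ∈ U.Uiso Γ₁ K (Ψ 1) σ →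
        ⟪emb Γ₁ (U.cup2C (U.pms L ι₁ V Γ₁) 1 ω₁ ω₂), S.t34.ϑ χ Φ⟫_ℂ ≠ 0 →
          ∃ (Γ : Level V) (ω : Fin 4 → U.CohC (U.pms L ι₁ V Γ) 1), (∀ i, ω i ∈ U.Uiso Γ K (Ψ i) σ) ∧
            ⟪emb Γ (U.cup2C (U.pms L ι₁ V Γ) 1 (ω 2) (ω 3)), emb Γ (U.cup2C (U.pms L ι₁ V Γ) 1 (ω 0) (ω 1))⟫_ℂ ≠ 0 := by
  intro χ hχ Φ Γ₁ ω₁ ω₂ h₁ h₂ hne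
  -- the generator lies in the closed span of the slot-2,3 theta wedge-functions: one of them pairs non-trivially
  obtain ⟨u, ⟨Γ₂, ω₃, hω₃, ω₄, hω₄, rfl⟩, hu⟩ := exists_inner_ne_zero_of_mem_closure_span hne (hr χ hχ Φ)
  have hx : U.cup2C (U.pms L ι₁ V Γ₁) 1 ω₁ ω₂ ∈ (U.hodge (U.pms L ι₁ V Γ₁) 2).F 2 :=
    Universe.cup2C_mem_F_two_of_Uiso hH hcup2 Γ₁ K (Ψ 0) (Ψ 1) σ h₁ h₂
  have hy : U.cup2C (U.pms L ι₁ V Γ₂) 1 ω₃ ω₄ ∈ (U.hodge (U.pms L ι₁ V Γ₂) 2).F 2 :=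
    Universe.cup2C_mem_F_two_of_Uiso hH hcup2 Γ₂ K (Ψ 2) (Ψ 3) σ (Theta_sub 2 Γ₂ hω₃) (Theta_sub 3 Γ₂ hω₄)
  have hyx : ⟪emb Γ₂ (U.cup2C (U.pms L ι₁ V Γ₂) 1 ω₃ ω₄), emb Γ₁ (U.cup2C (U.pms L ι₁ V Γ₁) 1 ω₁ ω₂)⟫_ℂ ≠ 0 := by
    intro h0
    apply hu
    rw [← inner_conj_symm, h0, map_zero]
  -- level-meeting: one level `Γ`, two morphisms `f : P_Γ → P_{Γ₁}`, `g : P_Γ → P_{Γ₂}`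
  obtain ⟨Γ, f, g, hfg⟩ := levelMeet Γ₁ Γ₂ _ _ hx hy hyx
  have hf : U.pullC f 2 (U.cup2C (U.pms L ι₁ V Γ₁) 1 ω₁ ω₂) =
      U.cup2C (U.pms L ι₁ V Γ) 1 (U.pullC f 1 ω₁) (U.pullC f 1 ω₂) := Universe.pullC_cup2C hpc f 1 ω₁ ω₂
  have hg : U.pullC g 2 (U.cup2C (U.pms L ι₁ V Γ₂) 1 ω₃ ω₄) =
      U.cup2C (U.pms L ι₁ V Γ) 1 (U.pullC g 1 ω₃) (U.pullC g 1 ω₄) := Universe.pullC_cup2C hpc g 1 ω₃ ω₄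
  rw [hf, hg] at hfg
  refine ⟨Γ, ![U.pullC f 1 ω₁, U.pullC f 1 ω₂, U.pullC g 1 ω₃, U.pullC g 1 ω₄], fun i => ?_, hfg⟩
  match i with
  | 0 => exact Universe.pullC_mem_Uiso hc f K (Ψ 0) σ h₁
  | 1 => exact Universe.pullC_mem_Uiso hc f K (Ψ 1) σ h₂
  | 2 => exact Universe.pullC_mem_Uiso hc g K (Ψ 2) σ (Theta_sub 2 Γ₂ hω₃)
  | 3 => exact Universe.pullC_mem_Uiso hc g K (Ψ 3) σ (Theta_sub 3 Γ₂ hω₄)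

end Transposition.IsolationSpans

/-! ## §2  The display: (v-r) in generator form, level-meeting for `embOf` as ONE universal binder -/

namespace Model

open Transposition

/-- **Free face-period witnesses from the joint theta-pinned datum, (v-r) in GENERATOR form, given level-meeting for `embOf`.**
`hLM` is token-shaped on `Model.embOf_levelMeet` (item (iii) D3/D4, tr-prover-3; not landed at filing time).  Reduction to
`exists_periodNV_free_of_jointThetaPin_meeting` by `real34Meet_of_generators_levelMeet` with `Θ := S.Theta`, the model facts
`universeOf_fact_pull_comp/_pull_hodge/_cup2_hodge/_pull_cup` and `2 < 6 ≤ [F:ℚ]`. [folklore] -/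
theorem exists_periodNV_free_of_jointThetaPin_levelMeet (hHD : exists_isReal_hodgeModel)
    (hI : hodgePQ_independent_of_hodgeModel) (h₁ : BallQuotientUniformised) (h₃ : CMAbelianVarietyRealised)
    (hLM : ∀ {L : CMField} (_ : 2 < Module.finrank ℚ L) {ι₁ : L →+* ℂ} (V : HermSpace3 L ι₁) (Γ₁ Γ₂ : Level V)
      (x : (picardCMUniverse hHD hI h₁ h₃).CohC ((picardCMUniverse hHD hI h₁ h₃).pms L ι₁ V Γ₁) 2)
      (y : (picardCMUniverse hHD hI h₁ h₃).CohC ((picardCMUniverse hHD hI h₁ h₃).pms L ι₁ V Γ₂) 2),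
      x ∈ ((picardCMUniverse hHD hI h₁ h₃).hodge ((picardCMUniverse hHD hI h₁ h₃).pms L ι₁ V Γ₁) 2).F 2 →
      y ∈ ((picardCMUniverse hHD hI h₁ h₃).hodge ((picardCMUniverse hHD hI h₁ h₃).pms L ι₁ V Γ₂) 2).F 2 →
      ⟪embOf hHD hI (ballQuotientUniformisedDatum_of h₁) h₃ Γ₂ y,
        embOf hHD hI (ballQuotientUniformisedDatum_of h₁) h₃ Γ₁ x⟫_ℂ ≠ 0 →
        ∃ (Γ : Level V) (f : (picardCMUniverse hHD hI h₁ h₃).Mor ((picardCMUniverse hHD hI h₁ h₃).pms L ι₁ V Γ)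
            ((picardCMUniverse hHD hI h₁ h₃).pms L ι₁ V Γ₁))
          (g : (picardCMUniverse hHD hI h₁ h₃).Mor ((picardCMUniverse hHD hI h₁ h₃).pms L ι₁ V Γ)
            ((picardCMUniverse hHD hI h₁ h₃).pms L ι₁ V Γ₂)),
          ⟪embOf hHD hI (ballQuotientUniformisedDatum_of h₁) h₃ Γ ((picardCMUniverse hHD hI h₁ h₃).pullC g 2 y),
            embOf hHD hI (ballQuotientUniformisedDatum_of h₁) h₃ Γ ((picardCMUniverse hHD hI h₁ h₃).pullC f 2 x)⟫_ℂ ≠ 0)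
    (h : ∀ (F : CMField), IsGalois ℚ F → 6 ≤ Module.finrank ℚ F → ∀ f : Face F,
      ∃ (ι₁ : F →+* ℂ) (V : HermSpace3 F ι₁) (σ : F →+* ℂ)
        (S : FaceThetaSupply (picardCMUniverse hHD hI h₁ h₃) ι₁ V F f.psi σ)
        (H CG G SK SigIdx SigIdxG : Type)
        (_ : NormedAddCommGroup H) (_ : InnerProductSpace ℂ H) (_ : CompleteSpace H)
        (_ : NormedAddCommGroup CG) (_ : NormedSpace ℂ CG) (_ : Group G) (_ : TopologicalSpace G) (_ : TopologicalSpace SK)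
        (Siso : Perl34.IsolationSetting H (Lp ℂ 2 V.autMeasure) CG G SK SigIdx SigIdxG),
        S.TranslateClosed (Transposition.Model.heckeFamily hHD hI h₁ h₃) ∧
        (∀ (Γ : Level V) (ω₁ ω₂ : (picardCMUniverse hHD hI h₁ h₃).CohC ((picardCMUniverse hHD hI h₁ h₃).pms F ι₁ V Γ) 1),
          ω₁ ∈ S.Theta 0 Γ → ω₂ ∈ S.Theta 1 Γ →
          embOf hHD hI (ballQuotientUniformisedDatum_of h₁) h₃ Γ
              ((picardCMUniverse hHD hI h₁ h₃).cup2C ((picardCMUniverse hHD hI h₁ h₃).pms F ι₁ V Γ) 1 ω₁ ω₂) ≠ 0 →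
            ∃ u ∈ Siso.t12.S12,
              ⟪embOf hHD hI (ballQuotientUniformisedDatum_of h₁) h₃ Γ
                  ((picardCMUniverse hHD hI h₁ h₃).cup2C ((picardCMUniverse hHD hI h₁ h₃).pms F ι₁ V Γ) 1 ω₁ ω₂), u⟫_ℂ ≠ 0) ∧
        (∀ χ : Siso.t34.X, Siso.t34.allowed χ → ∀ Φ : SK,
          Siso.t34.ϑ χ Φ ∈ (Submodule.span ℂ
            (thetaWedgeFns (picardCMUniverse hHD hI h₁ h₃) (embOf hHD hI (ballQuotientUniformisedDatum_of h₁) h₃)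
              S.Theta 2 3)).topologicalClosure)) :
    ∀ (F : CMField), IsGalois ℚ F → 6 ≤ Module.finrank ℚ F → ∀ f : Face F,
      ∃ (ι₁ : F →+* ℂ) (V : HermSpace3 F ι₁) (σ : F →+* ℂ), (picardCMUniverse hHD hI h₁ h₃).PeriodNV ι₁ V F f.psi σ := by
  refine exists_periodNV_free_of_jointThetaPin_meeting hHD hI h₁ h₃ fun F hG h6 f => ?_
  obtain ⟨ι₁, V, σ, S, H, CG, G, SK, SigIdx, SigIdxG, _, _, _, _, _, _, _, _, Siso, hT, hg, hr⟩ := h F hG h6 f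
  have hL : 2 < Module.finrank ℚ F := by omega
  exact ⟨ι₁, V, σ, S, H, CG, G, SK, SigIdx, SigIdxG, _, _, _, _, _, _, _, _, Siso, hT, hg,
    IsolationSpans.real34Meet_of_generators_levelMeet
      (universeOf_fact_pull_comp hHD hI (ballQuotientUniformisedDatum_of h₁) h₃)
      (universeOf_fact_pull_hodge hHD hI (ballQuotientUniformisedDatum_of h₁) h₃)
      (universeOf_fact_cup2_hodge hHD hI (ballQuotientUniformisedDatum_of h₁) h₃)
      (universeOf_fact_pull_cup hHD hI (ballQuotientUniformisedDatum_of h₁) h₃) Siso S.Theta_sub hr (hLM hL V)⟩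

/-- **The joint theta-pinned end display, clause-per-lane form**: per face, DATA `S` [S2] and `Siso` [(v-S)] with (1) translate-closure,
(2′) C5′ `gen12Meet` [(v-g′)] and (3) the GENERATOR form of `Real34` [(v-r)]; plus ONE universal binder `hLM` = level-meeting for
`Model.embOf` [(iii) C1′, `Model.embOf_levelMeet` when it lands]; `hR` = Hom-fullness (a tree theorem on the universe of record).
`HC_CM` is NOT proved. [folklore] -/
theorem hc_cm_of_jointThetaPin_levelMeet (hHD : exists_isReal_hodgeModel) (hI : hodgePQ_independent_of_hodgeModel)
    (h₁ : BallQuotientUniformised) (h₃ : CMAbelianVarietyRealised) (hR : DeligneMilne1982_Thm_6_20_full)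
    (hLM : ∀ {L : CMField} (_ : 2 < Module.finrank ℚ L) {ι₁ : L →+* ℂ} (V : HermSpace3 L ι₁) (Γ₁ Γ₂ : Level V)
      (x : (picardCMUniverse hHD hI h₁ h₃).CohC ((picardCMUniverse hHD hI h₁ h₃).pms L ι₁ V Γ₁) 2)
      (y : (picardCMUniverse hHD hI h₁ h₃).CohC ((picardCMUniverse hHD hI h₁ h₃).pms L ι₁ V Γ₂) 2),
      x ∈ ((picardCMUniverse hHD hI h₁ h₃).hodge ((picardCMUniverse hHD hI h₁ h₃).pms L ι₁ V Γ₁) 2).F 2 →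
      y ∈ ((picardCMUniverse hHD hI h₁ h₃).hodge ((picardCMUniverse hHD hI h₁ h₃).pms L ι₁ V Γ₂) 2).F 2 →
      ⟪embOf hHD hI (ballQuotientUniformisedDatum_of h₁) h₃ Γ₂ y,
        embOf hHD hI (ballQuotientUniformisedDatum_of h₁) h₃ Γ₁ x⟫_ℂ ≠ 0 →
        ∃ (Γ : Level V) (f : (picardCMUniverse hHD hI h₁ h₃).Mor ((picardCMUniverse hHD hI h₁ h₃).pms L ι₁ V Γ)
            ((picardCMUniverse hHD hI h₁ h₃).pms L ι₁ V Γ₁))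
          (g : (picardCMUniverse hHD hI h₁ h₃).Mor ((picardCMUniverse hHD hI h₁ h₃).pms L ι₁ V Γ)
            ((picardCMUniverse hHD hI h₁ h₃).pms L ι₁ V Γ₂)),
          ⟪embOf hHD hI (ballQuotientUniformisedDatum_of h₁) h₃ Γ ((picardCMUniverse hHD hI h₁ h₃).pullC g 2 y),
            embOf hHD hI (ballQuotientUniformisedDatum_of h₁) h₃ Γ ((picardCMUniverse hHD hI h₁ h₃).pullC f 2 x)⟫_ℂ ≠ 0)
    (h : ∀ (F : CMField), IsGalois ℚ F → 6 ≤ Module.finrank ℚ F → ∀ f : Face F,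
      ∃ (ι₁ : F →+* ℂ) (V : HermSpace3 F ι₁) (σ : F →+* ℂ)
        (S : FaceThetaSupply (picardCMUniverse hHD hI h₁ h₃) ι₁ V F f.psi σ)
        (H CG G SK SigIdx SigIdxG : Type)
        (_ : NormedAddCommGroup H) (_ : InnerProductSpace ℂ H) (_ : CompleteSpace H)
        (_ : NormedAddCommGroup CG) (_ : NormedSpace ℂ CG) (_ : Group G) (_ : TopologicalSpace G) (_ : TopologicalSpace SK)
        (Siso : Perl34.IsolationSetting H (Lp ℂ 2 V.autMeasure) CG G SK SigIdx SigIdxG),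
        S.TranslateClosed (Transposition.Model.heckeFamily hHD hI h₁ h₃) ∧
        (∀ (Γ : Level V) (ω₁ ω₂ : (picardCMUniverse hHD hI h₁ h₃).CohC ((picardCMUniverse hHD hI h₁ h₃).pms F ι₁ V Γ) 1),
          ω₁ ∈ S.Theta 0 Γ → ω₂ ∈ S.Theta 1 Γ →
          embOf hHD hI (ballQuotientUniformisedDatum_of h₁) h₃ Γ
              ((picardCMUniverse hHD hI h₁ h₃).cup2C ((picardCMUniverse hHD hI h₁ h₃).pms F ι₁ V Γ) 1 ω₁ ω₂) ≠ 0 →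
            ∃ u ∈ Siso.t12.S12,
              ⟪embOf hHD hI (ballQuotientUniformisedDatum_of h₁) h₃ Γ
                  ((picardCMUniverse hHD hI h₁ h₃).cup2C ((picardCMUniverse hHD hI h₁ h₃).pms F ι₁ V Γ) 1 ω₁ ω₂), u⟫_ℂ ≠ 0) ∧
        (∀ χ : Siso.t34.X, Siso.t34.allowed χ → ∀ Φ : SK,
          Siso.t34.ϑ χ Φ ∈ (Submodule.span ℂ
            (thetaWedgeFns (picardCMUniverse hHD hI h₁ h₃) (embOf hHD hI (ballQuotientUniformisedDatum_of h₁) h₃)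
              S.Theta 2 3)).topologicalClosure)) :
    HC_CM :=
  hc_cm_of_exists_facePeriod_free hHD hI h₁ h₃ (exists_periodNV_free_of_jointThetaPin_levelMeet hHD hI h₁ h₃ hLM h) hR

/-- **The clause-per-lane joint display on the universe OF RECORD** (the four `_holds` data and `deligneMilne1982_Thm_6_20_full_holds`
plugged in; TWO hypotheses: the universal level-meeting binder `hLM` for `Model.embOf` and the per-face datum `h`).  `HC_CM` is NOT
proved. [folklore] -/
theorem hc_cm_of_jointThetaPin_levelMeet_rec :
    let U := picardCMUniverse exists_isReal_hodgeModel_holds hodgePQ_independent_of_hodgeModel_holds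
      BallQuotient.ballQuotientUniformised_holds cmAbelianVarietyRealised_holds
    let hU := ballQuotientUniformisedDatum_of BallQuotient.ballQuotientUniformised_holds
    (∀ {L : CMField} (_ : 2 < Module.finrank ℚ L) {ι₁ : L →+* ℂ} (V : HermSpace3 L ι₁) (Γ₁ Γ₂ : Level V)
      (x : U.CohC (U.pms L ι₁ V Γ₁) 2) (y : U.CohC (U.pms L ι₁ V Γ₂) 2),
      x ∈ (U.hodge (U.pms L ι₁ V Γ₁) 2).F 2 → y ∈ (U.hodge (U.pms L ι₁ V Γ₂) 2).F 2 →
      ⟪embOf exists_isReal_hodgeModel_holds hodgePQ_independent_of_hodgeModel_holds hU cmAbelianVarietyRealised_holds Γ₂ y,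
        embOf exists_isReal_hodgeModel_holds hodgePQ_independent_of_hodgeModel_holds hU cmAbelianVarietyRealised_holds Γ₁ x⟫_ℂ
          ≠ 0 →
        ∃ (Γ : Level V) (f : U.Mor (U.pms L ι₁ V Γ) (U.pms L ι₁ V Γ₁)) (g : U.Mor (U.pms L ι₁ V Γ) (U.pms L ι₁ V Γ₂)),
          ⟪embOf exists_isReal_hodgeModel_holds hodgePQ_independent_of_hodgeModel_holds hU cmAbelianVarietyRealised_holds Γ
              (U.pullC g 2 y),
            embOf exists_isReal_hodgeModel_holds hodgePQ_independent_of_hodgeModel_holds hU cmAbelianVarietyRealised_holds Γ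
              (U.pullC f 2 x)⟫_ℂ ≠ 0) →
    (∀ (F : CMField), IsGalois ℚ F → 6 ≤ Module.finrank ℚ F → ∀ f : Face F,
      ∃ (ι₁ : F →+* ℂ) (V : HermSpace3 F ι₁) (σ : F →+* ℂ)
        (S : FaceThetaSupply U ι₁ V F f.psi σ)
        (H CG G SK SigIdx SigIdxG : Type)
        (_ : NormedAddCommGroup H) (_ : InnerProductSpace ℂ H) (_ : CompleteSpace H)
        (_ : NormedAddCommGroup CG) (_ : NormedSpace ℂ CG) (_ : Group G) (_ : TopologicalSpace G) (_ : TopologicalSpace SK)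
        (Siso : Perl34.IsolationSetting H (Lp ℂ 2 V.autMeasure) CG G SK SigIdx SigIdxG),
        S.TranslateClosed (Transposition.Model.heckeFamily exists_isReal_hodgeModel_holds hodgePQ_independent_of_hodgeModel_holds
          BallQuotient.ballQuotientUniformised_holds cmAbelianVarietyRealised_holds) ∧
        (∀ (Γ : Level V) (ω₁ ω₂ : U.CohC (U.pms F ι₁ V Γ) 1), ω₁ ∈ S.Theta 0 Γ → ω₂ ∈ S.Theta 1 Γ →
          embOf exists_isReal_hodgeModel_holds hodgePQ_independent_of_hodgeModel_holds hU cmAbelianVarietyRealised_holds Γ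
              (U.cup2C (U.pms F ι₁ V Γ) 1 ω₁ ω₂) ≠ 0 →
            ∃ u ∈ Siso.t12.S12,
              ⟪embOf exists_isReal_hodgeModel_holds hodgePQ_independent_of_hodgeModel_holds hU cmAbelianVarietyRealised_holds Γ
                  (U.cup2C (U.pms F ι₁ V Γ) 1 ω₁ ω₂), u⟫_ℂ ≠ 0) ∧
        (∀ χ : Siso.t34.X, Siso.t34.allowed χ → ∀ Φ : SK,
          Siso.t34.ϑ χ Φ ∈ (Submodule.span ℂ (thetaWedgeFns U
            (embOf exists_isReal_hodgeModel_holds hodgePQ_independent_of_hodgeModel_holds hU cmAbelianVarietyRealised_holds)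
              S.Theta 2 3)).topologicalClosure)) →
    HC_CM :=
  fun hLM h ↦ hc_cm_of_jointThetaPin_levelMeet _ _ _ _ deligneMilne1982_Thm_6_20_full_holds hLM h

#print axioms hc_cm_of_jointThetaPin_levelMeet_rec

end Model

end Summit.HodgeConjecture.CorCM

end
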